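import Summits.HodgeConjecture.HodgeConjecture.Theorems.WeilTypeLadderLocalAnchorFourMul
import Summits.HodgeConjecture.HodgeConjecture.Theorems.HeckePrymWeilHyperbolicEightfoldsSqrtMinus7OfAnchorObject
import HarnessLib

/-!
# Crux `HeckePrymWeil.HyperbolicEightfoldsSqrtMinus7` (stmt-HodgeConjecture-14642) from ONE locally algebraic anchor

b2b cell `hweil`, prover 2 gen 3. The line `euler-squeeze-rank-two-secant-bundle` of the crux composed the crux from
Deligne's reach (`weilFamilyReach_hyperbolic`), Perry's theorem, a standard Chern character and ONE semiregular anchor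
OBJECT (`hyperbolicEightfoldsSqrtMinus7_of_anchorObject`, its hypothesis `hO` = the registered stub
`SecantAnchorObject47`). The CLASS-level predicate `HasLocallyAlgebraicWeilAnchor 4 7`
(`Literature/…/WeilClassesLocalAnchor.lean`) is WEAKER than (Perry ∧ object) — it is implied by them
(`WeilTypeLadder.hasLocallyAlgebraicWeilAnchor_of_perryTwisted_kappaAnchorObject`) and by any other engine producing an
open neighbourhood of algebraic fibres at one hyperbolic `√-7` eightfold (twisted reflexive sheaves à la Markman §7.5,
Bloch semiregular cycles, …). This file records that the crux follows from reach and that predicate alone: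

* `hyperbolicEightfoldsSqrtMinus7_of_reach_of_localAnchor : weilFamilyReach_hyperbolic →
  HasLocallyAlgebraicWeilAnchor 4 7 → HyperbolicEightfoldsSqrtMinus7`;
* `hyperbolicEightfoldsSqrtMinus7_of_reach_of_localAnchor_twentyEight` — the same from an anchor with `ψ₀² = -28`
  (`ℚ(√-28) = ℚ(√-7)`; the `(A, φ, 7) ↦ (A, 2φ, 28)` transport of `…LocalAnchorFourMul`, kernel-checked), the regime in
  which a Markman-type even-`d` secant construction would live one genus up.

Nothing is asserted; sorry-free; no definition. Serves stmt-HodgeConjecture-14642 without closing it.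
-/

noncomputable section

-- single-problem summit (Problem = Summit): the mandated namespace repeats `HodgeConjecture`.
set_option linter.dupNamespace false

open CategoryTheory AlgebraicGeometry
open Literature.AlgebraicGeometry Literature.AlgebraicGeometry.Motives
  Literature.AlgebraicGeometry.HodgeTheory
open Literature.AlgebraicTopology.SingularHomology
open Summit.HodgeConjecture.HodgeConjecture.Theorems.HeckePrymWeilLine (stub_upgrade)
open Summit.HodgeConjecture.HodgeConjecture.WeilTypeLadder
  (weilClasses_algebraic_hyperbolic_of_localAnchor weilClasses_algebraic_hyperbolic_of_localAnchor_four_mul)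

namespace Summit.HodgeConjecture.HodgeConjecture.Theorems.HyperbolicEightfoldsSqrtMinus7.LocalAnchor

/-- **The crux from Deligne's reach and ONE locally algebraic hyperbolic `√-7` anchor in dimension 8.** Given a
hyperbolic `(A, φ, e_A, a_A)` and a rational `(4,4)` class `c` of the typed Weil plane: `c` lies in the strong Weil
plane (`stub_upgrade`), which is algebraic by `weilClasses_algebraic_hyperbolic_of_localAnchor 4 7` (W-engine, Baire
LOCAL⟹GLOBAL, Lefschetz+Kleiman, one-class-suffices, isogeny transfer — all kernel-checked). The casts `(7 : ℤ) • 𝟙`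
vs `(7 : ℕ) • 𝟙` and `(7 : ℂ)` vs `((7 : ℕ) : ℂ)` are the only bookkeeping. [cite: Markman2025SecantWeil, §1.2 and §1.5]
[cite: Deligne1982HodgeCycles, proof of Thm. 4.8] [cite: CharlesSchnell2014Notes, Prop. 11.3.11 (proof)] -/
theorem hyperbolicEightfoldsSqrtMinus7_of_reach_of_localAnchor (hF : weilFamilyReach_hyperbolic)
    (hL : HasLocallyAlgebraicWeilAnchor 4 7) :
    Summit.HodgeConjecture.HodgeConjecture.Theses.HeckePrymWeil.HyperbolicEightfoldsSqrtMinus7 := by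
  intro A φ hA hφ eA aA haA haA0 hhypA c _ _ hW
  have hA' : A.dim = 2 * 4 := hA
  have hcW : c ∈ weilClassesOf A φ 4 7 := stub_upgrade 7 (by norm_num) (by norm_num) le_rfl 4 A φ hA' hφ hW
  have h7 : ((7 : ℕ) : ℂ) = (7 : ℂ) := Nat.cast_ofNat
  have hφ' : φ ≫ φ = -((7 : ℕ) • 𝟙 A) := by rw [hφ, ← natCast_zsmul]; rfl
  have hhypA' : IsHyperbolicWeilType A φ 4
      (((7 : ℕ) : ℂ) • complexBetti.map eA.ι 2 aA + complexBetti.map φ.hom.hom.hom 2 (complexBetti.map eA.ι 2 aA)) := by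
    rw [h7]; exact hhypA
  exact weilClasses_algebraic_hyperbolic_of_localAnchor 4 7 (by norm_num) (by norm_num) hL hF A φ hA' hφ' eA aA haA
    haA0 hhypA' hcW

/-- **The crux from reach and ONE locally algebraic hyperbolic anchor with `ψ₀² = -28`** (`ℚ(√-28) = ℚ(√-7)`, the
even-`d` regime of a Markman-type construction): the `(A, φ, 7) ↦ (A, 2φ, 28)` transport is
`weilClasses_algebraic_hyperbolic_of_localAnchor_four_mul 4 7`. [cite: Markman2025SecantWeil, §1.5 (footnote: d ↦ 4d)]
[cite: Deligne1982HodgeCycles, proof of Thm. 4.8] -/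
theorem hyperbolicEightfoldsSqrtMinus7_of_reach_of_localAnchor_twentyEight (hF : weilFamilyReach_hyperbolic)
    (hL : HasLocallyAlgebraicWeilAnchor 4 (4 * 7)) :
    Summit.HodgeConjecture.HodgeConjecture.Theses.HeckePrymWeil.HyperbolicEightfoldsSqrtMinus7 := by
  intro A φ hA hφ eA aA haA haA0 hhypA c _ _ hW
  have hA' : A.dim = 2 * 4 := hA
  have hcW : c ∈ weilClassesOf A φ 4 7 := stub_upgrade 7 (by norm_num) (by norm_num) le_rfl 4 A φ hA' hφ hW
  have h7 : ((7 : ℕ) : ℂ) = (7 : ℂ) := Nat.cast_ofNat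
  have hφ' : φ ≫ φ = -((7 : ℕ) • 𝟙 A) := by rw [hφ, ← natCast_zsmul]; rfl
  have hhypA' : IsHyperbolicWeilType A φ 4
      (((7 : ℕ) : ℂ) • complexBetti.map eA.ι 2 aA + complexBetti.map φ.hom.hom.hom 2 (complexBetti.map eA.ι 2 aA)) := by
    rw [h7]; exact hhypA
  exact weilClasses_algebraic_hyperbolic_of_localAnchor_four_mul 4 7 (by norm_num) (by norm_num) hL hF A φ hA' hφ'
    eA aA haA haA0 hhypA' hcW

end Summit.HodgeConjecture.HodgeConjecture.Theorems.HyperbolicEightfoldsSqrtMinus7.LocalAnchor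

end
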